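import Summits.ValiantsHypothesis.ValiantsHypothesis.Theorems.KPlusLogSqLawTropicalBToeplitzAdmissible
import Summits.ValiantsHypothesis.ValiantsHypothesis.Theorems.KPlusLogSqLawTropicalBToeplitzEight28
import Summits.ValiantsHypothesis.ValiantsHypothesis.Theorems.KPlusLogSqLawTropicalBToeplitzNine31
import Summits.ValiantsHypothesis.ValiantsHypothesis.Theorems.KPlusLogSqLawTropicalBToeplitzTen36
import Summits.ValiantsHypothesis.ValiantsHypothesis.Theorems.KPlusLogSqLawTropicalBToeplitzEleven43
import Summits.ValiantsHypothesis.ValiantsHypothesis.Theorems.KPlusLogSqLawTropicalBToeplitzTwelve48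
import Summits.ValiantsHypothesis.ValiantsHypothesis.Theorems.KPlusLogSqLawTropicalBToeplitzThirteen52
import Summits.ValiantsHypothesis.ValiantsHypothesis.Theorems.KPlusLogSqLawTropicalBToeplitzFourteen54
import Summits.ValiantsHypothesis.ValiantsHypothesis.Theorems.KPlusLogSqLawTropicalBToeplitzFifteen55
import Summits.ValiantsHypothesis.ValiantsHypothesis.Theorems.KPlusLogSqLawTropicalBToeplitzSixteen58

/-!
# Route `KPlusLogSqLaw`, crux `TropicalB` — Conjecture T: the kernel LOWER TABLE of record after seat val-sym-trop-p3 g4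

HONEST FRAMING.  Helper toward the registered stubs `stub_tropThin` / `stub_tropFat` of `Cruxes/TropicalB/Lines/birth.lean` (crux
`Summit.ValiantsHypothesis.ValiantsHypothesis.Theses.KPlusLogSqLaw.TropicalB`, ledger item `stmt-ValiantsHypothesis-19771`, route
`KPlusLogSqLaw`; cell `pub-symmetroid`, seat `val-sym-trop-p3` (g4), 2026-08-27).  ONE citable statement collecting this seat's kernel
rows of the cell's Conjecture T table (Φ_Toep(8) ≥ 28 · Φ_Toep(9) ≥ 31 · Φ_Toep(10) ≥ 36 · Φ_Toep(11) ≥ 43 · Φ_Toep(12) ≥ 48 · Φ_Toep(13) ≥ 52 · Φ_Toep(14) ≥ 54 · Φ_Toep(15) ≥ 55 · Φ_Toep(16) ≥ 58), each an explicit linear Toeplitz instance with that many unique optima certified by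
strict LP duality in its own file, propagated to every larger size by corner-pin monotonicity (`LinearInstanceBound.of_le`).  Ratios
28/8 = 3.50, 31/9 = 3.44, 36/10 = 3.60, 43/11 = 3.91, 48/12 = 4.00, 52/13 = 4.00, 54/14 = 3.86, 55/15 = 3.67, 58/16 = 3.62: the located law «slope ≈ 3» (CONJT-METHOD-g22 §0) is superseded in the kernel; `ConjectureTSharp` (`≤ 5m`) is untouched.
These are LOWER bounds from unconverged hub climbs (instrument `c/phull.c`, HOME/val-sym-trop-p3/g4/); nothing bounds `Φ_Toep` from
above; Conjecture T (`O(m)` / `poly(m)`) stays OPEN, and nothing bears on `TropicalB` for general designs, `KPlusLogSqLaw`,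
`MatrixDescartes` or `VP ≠ VNP`.  Supersedes-in-part `…ToeplitzTable` (p459641: rows 18/23/26/28 at m ≥ 6/7/8/9).
-/

set_option linter.dupNamespace false
set_option autoImplicit false

namespace Summit.ValiantsHypothesis.ValiantsHypothesis.Theorems.KPlusLogSqLaw.Toeplitz

/-- **Kernel lower table (this seat)**: `LinearInstanceBound m Φ` forces «m ≥ 8 ⇒ Φ ≥ 28», «m ≥ 9 ⇒ Φ ≥ 31», «m ≥ 10 ⇒ Φ ≥ 36», «m ≥ 11 ⇒ Φ ≥ 43», «m ≥ 12 ⇒ Φ ≥ 48», «m ≥ 13 ⇒ Φ ≥ 52», «m ≥ 14 ⇒ Φ ≥ 54», «m ≥ 15 ⇒ Φ ≥ 55», «m ≥ 16 ⇒ Φ ≥ 58».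
[folklore] -/
theorem lowerTable2_of_linearInstanceBound {m Φ : ℕ} (h : LinearInstanceBound m Φ) :
      (8 ≤ m → 28 ≤ Φ) ∧
      (9 ≤ m → 31 ≤ Φ) ∧
      (10 ≤ m → 36 ≤ Φ) ∧
      (11 ≤ m → 43 ≤ Φ) ∧
      (12 ≤ m → 48 ≤ Φ) ∧
      (13 ≤ m → 52 ≤ Φ) ∧
      (14 ≤ m → 54 ≤ Φ) ∧
      (15 ≤ m → 55 ≤ Φ) ∧
      (16 ≤ m → 58 ≤ Φ) :=
  ⟨fun hm => le_of_linearInstanceBound_ge_eight_28 hm h, fun hm => le_of_linearInstanceBound_ge_nine_31 hm h, fun hm => le_of_linearInstanceBound_ge_ten_36 hm h, fun hm => le_of_linearInstanceBound_ge_eleven_43 hm h, fun hm => le_of_linearInstanceBound_ge_twelve_48 hm h, fun hm => le_of_linearInstanceBound_ge_thirteen_52 hm h, fun hm => le_of_linearInstanceBound_ge_fourteen_54 hm h, fun hm => le_of_linearInstanceBound_ge_fifteen_55 hm h, fun hm => le_of_linearInstanceBound_ge_sixteen_58 hm h⟩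

/-- the same in the admissible-set-free currency (`…ToeplitzAdmissible`). -/
theorem lowerTable2_of_freeInstanceBound {m Φ : ℕ} (h : FreeInstanceBound m Φ) :
      (8 ≤ m → 28 ≤ Φ) ∧
      (9 ≤ m → 31 ≤ Φ) ∧
      (10 ≤ m → 36 ≤ Φ) ∧
      (11 ≤ m → 43 ≤ Φ) ∧
      (12 ≤ m → 48 ≤ Φ) ∧
      (13 ≤ m → 52 ≤ Φ) ∧
      (14 ≤ m → 54 ≤ Φ) ∧
      (15 ≤ m → 55 ≤ Φ) ∧
      (16 ≤ m → 58 ≤ Φ) :=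
  lowerTable2_of_linearInstanceBound (LinearInstanceBound.of_free h)

end Summit.ValiantsHypothesis.ValiantsHypothesis.Theorems.KPlusLogSqLaw.Toeplitz
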